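import Literature.AlgebraicGeometry.AbelianVarieties.LineBundleTensorPower
import Literature.AlgebraicGeometry.AbelianVarieties.HomogeneousLineBundleDivisor
import Literature.AlgebraicGeometry.AbelianSchemes.ModuleSliceOfBaseChange
import Literature.AlgebraicGeometry.AbelianSchemes.AbelianSchemeBaseChangeComp
import Literature.AlgebraicGeometry.Modules.UnitCocyclePresented
import HarnessLib

/-!
# Rigidifying a line bundle on `A ×_S B` along `ε_A × 1_B` (Mumford's normalisation of the Poincaré sheaf)

Layer `Literature/AlgebraicGeometry/AbelianSchemes`, namespace
`Literature.AlgebraicGeometry.AbelianSchemes.AbelianSchemeOver`.  ONE definition with body (`rigidify`, a module: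
the construction `P ⊗ (pr_B^* (ε_A × 1_B)^* P)^∨`) and theorems; no `def … : Prop`, no named fact, no instance, no
notation, no `sorry`.

[MumfordFogartyKirwan1994, Ch. 6 §2 (p. 121)]: the universal sheaf on `X ×_S X̂` is «normalized so that the sheaf
induced on `X̂` via `ε × 1_{X̂}` is `𝒪_{X̂}`»; [MilneAV2008, I §8 (proof of 8.4)]: any family `ℒ` on `A × T` is
replaced by `ℒ ⊗ pr_T^*(ℒ|_{{0} × T})^{-1}`, which is rigidified along the zero section and has the same fibres
`ℒ|_{A × {t}}`.  For abelian schemes `A`, `B` over `S` and a rank-one module `P` on `A ×_S B` (★ `prodLeft`):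

* §1 (any abelian variety `A₀/K`) `isHomogeneous_pullback_hom` — a module pulled back from `Spec K` along the
  structure map is translation invariant; **`isHomogeneous_tensorObj_iff_of_isHomogeneous_right`** — twisting a
  rank-one module by a translation-invariant rank-one module does not change translation invariance
  (`[t_x^*(E ⊗ F)] = t_x^*[E] · t_x^*[F]` in `Ȟ¹(A₀, 𝒪^×)`, ★ `isHomogeneous_iff_forall_pullback_detClass_eq`);
* §2 **`rigidify A B P := P ⊗ (pr_B^* ((ε_A × 1_B)^* P))^∨`** with `hasRank_rigidify`,
  **`nonempty_pullback_unitSlice_rigidify_iso`** (`(ε_A × 1_B)^* (rigidify P) ≅ 𝒪_B`: `(ε × 1) ≫ pr_B = 𝟙`, so the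
  class is `ε^*[P] · (ε^*[P])⁻¹ = 1`), and **`isHomogeneous_fibreSlice_rigidify_iff`** (clause (a) of ★ `DualPair` is
  unchanged: the slice at a geometric point `b` changes by the twist `π_s^*(b^*N)^∨` pulled back from `Spec Ω`);
* §3 `unitSlice_comp_whiskerLeft_left` (`(ε × 1_{B′}) ≫ (1 × q) = q ≫ (ε × 1_B)`),
  `unitSection_baseChange_eq_unitSlice` (the unit section of `A_{B′}` IS `ε_A × 1_{B′}`), and
  **`nonempty_pullback_whiskerLeft_rigidify_iso`** — if `(1_A × q)^* P ≅ ℒ.L` for a RIGIDIFIED line bundle `ℒ` on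
  `A_{B′}`, then also `(1_A × q)^* (rigidify P) ≅ ℒ.L` (the twist pulls back to `pr^* (ε′^* ℒ.L)^∨ ≅ 𝒪`);
* §4 **`nonempty_iso_unit_of_pullback_iso_tensorObj`** / **`nonempty_pullback_iso_of_iso_tensorObj`** — the
  twist-killer of universality proofs: if `P` is rigidified along `ε_A × 1_B`, `ℒ` is a rigidified line bundle on
  `A_T` and `(1_A × g)^* P ≅ ℒ.L ⊗ pr_T^* M` for a line bundle `M` on `T`, then `M ≅ 𝒪_T` and
  `(1_A × g)^* P ≅ ℒ.L` (restrict along `ε_T`: `ε_T ≫ (1 × g) = g ≫ (ε × 1)`, `ε_T ≫ pr_T = 𝟙`).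

All isomorphisms of rank-one modules are produced from identities of determinant classes in the commutative groups
`Ȟ¹(·, 𝒪^×)` (★ `nonempty_iso_iff_detClass_eq`, ★ `detClass_tensorObj_of_hasRank_one`, ★ `detClass_dual`, ★
`detClass_pullback`, ★ `CechPic.pullback_comp`).  Use (cell `hodgecm-mathlib`, HECKE-LINK H2 file (ii)): the
descended Poincaré sheaf `𝒫_B = poincareQuot Φ` on `(A/K) ×_S (Â/K′)` may be replaced by `rigidify 𝒫_B`, for which
clause (b) `rigid` of ★ `DualPair` holds by §2, clause (a) and the defining isomorphism `(1 × ψ̂)^* 𝒫_B ≅ 𝒩₁`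
survive by §2–§3, and §4 removes the `pr_T^*`-ambiguity in the universality clause.  HC_CM is proved only modulo the
7 printed citations until rung 0 closes; nothing here is about HC.

## References
* [MumfordFogartyKirwan1994] D. Mumford, J. Fogarty, F. Kirwan, *Geometric Invariant Theory*, 3rd ed. (1994),
  Ch. 6 §2 (p. 121).
* [MilneAV2008] J. S. Milne, *Abelian Varieties* (2008), I §8 (pp. 36–37).
* [MumfordAV1970] D. Mumford, *Abelian Varieties* (1970), §8 ((iv) ⇔ (i)), §13 (p. 125).
* [Hartshorne1977] R. Hartshorne, *Algebraic Geometry* (1977), II Prop. 6.12, II Ex. 6.8, III Ex. 4.5.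
-/

noncomputable section

-- `Scheme.Modules` / the `Over`-monoidal carriers are not reducible: `(A.X ⊗ B.X).left = A.prodLeft B` and
-- `(A.baseChange f).X.left = pullback A.X.hom f` hold by `rfl` only (as in Mathlib's `AlgebraicGeometry/Modules`).
set_option backward.isDefEq.respectTransparency false

universe u

open CategoryTheory CategoryTheory.Limits AlgebraicGeometry MonoidalCategory CartesianMonoidalCategory

/-! ### §1 Twisting by a module pulled back from the base point keeps translation invariance -/

namespace Literature.AlgebraicGeometry.AbelianVarieties

open Literature.AlgebraicGeometry.Motives Literature.AlgebraicGeometry.Modules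

variable {K : Type u} [Field K] (A : AbelianVariety K)

/-- A module pulled back from `Spec K` along the structure map `π : A → Spec K` is translation invariant:
`t_x^* π^* M ≅ (t_x ≫ π)^* M = π^* M`. [cite: MumfordAV1970, §8 ((iv) ⇔ (i))] -/
theorem isHomogeneous_pullback_hom (M : (Spec (.of K)).Modules) :
    IsHomogeneous A ((Scheme.Modules.pullback A.X.hom).obj M) := fun P =>
  ⟨(Scheme.Modules.pullbackComp _ _).app M ≪≫
    (Scheme.Modules.pullbackCongr (Over.w (A.translation P))).app M⟩

/-- **Twisting by a translation-invariant line bundle does not change translation invariance** (rank one):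
`[t_x^*(E ⊗ F)] = t_x^*[E] · t_x^*[F]` in `Ȟ¹(A, 𝒪^×)`, and rank-one modules are classified by their classes
(★ `isHomogeneous_iff_forall_pullback_detClass_eq`). [cite: MumfordAV1970, §8 ((iv) ⇔ (i))]
[cite: Hartshorne1977, II Prop. 6.12 and III Ex. 4.5] -/
theorem isHomogeneous_tensorObj_iff_of_isHomogeneous_right {E F : A.X.left.Modules} (hE : HasRank E 1)
    (hF : HasRank F 1) (h : IsHomogeneous A F) : IsHomogeneous A (tensorObj E F) ↔ IsHomogeneous A E := by
  have hE₁ := HasRank.isFiniteLocallyFree' hE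
  have hF₁ := HasRank.isFiniteLocallyFree' hF
  have hEF₁ := isFiniteLocallyFree_tensorObj E F hE₁ hF₁
  rw [isHomogeneous_iff_forall_pullback_detClass_eq A (hasRank_tensorObj_one hE hF) hEF₁,
    isHomogeneous_iff_forall_pullback_detClass_eq A hE hE₁]
  rw [isHomogeneous_iff_forall_pullback_detClass_eq A hF hF₁] at h
  refine forall_congr' fun P => ?_
  rw [detClass_tensorObj_of_hasRank_one hE hF hE₁ hF₁ hEF₁, map_mul, h P]
  exact mul_left_inj _

/-- **Twisting by a module pulled back from `Spec K` does not change translation invariance** (rank one).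
[cite: MumfordAV1970, §8 ((iv) ⇔ (i))] [cite: MilneAV2008, I §8 (pp. 36–37)] -/
theorem isHomogeneous_tensorObj_pullback_hom_iff {E : A.X.left.Modules} (hE : HasRank E 1)
    {M : (Spec (.of K)).Modules} (hM : HasRank M 1) :
    IsHomogeneous A (tensorObj E ((Scheme.Modules.pullback A.X.hom).obj M)) ↔ IsHomogeneous A E :=
  isHomogeneous_tensorObj_iff_of_isHomogeneous_right A hE (hasRank_pullback _ hM) (isHomogeneous_pullback_hom A M)

end Literature.AlgebraicGeometry.AbelianVarieties

namespace Literature.AlgebraicGeometry.AbelianSchemes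

namespace AbelianSchemeOver

open Literature.AlgebraicGeometry.Motives Literature.AlgebraicGeometry.AbelianVarieties
  Literature.AlgebraicGeometry.Modules

variable {S : Scheme.{u}} (A B : AbelianSchemeOver S)

/-! ### §2 `rigidify P = P ⊗ (pr_B^* (ε × 1)^* P)^∨`: rank one, rigidified, same slices -/

/-- **Rigidification of a module `P` on `A ×_S B` along `ε_A × 1_B`**: `P ⊗ (pr_B^* ((ε_A × 1_B)^* P))^∨` — the twist
by the inverse of the pull-back of `P|_{{0} × B}` ([MumfordFogartyKirwan1994] Ch. 6 §2 p. 121: «normalized so that the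
sheaf induced on `X̂` via `ε × 1_{X̂}` is `𝒪_{X̂}`»; [MilneAV2008] I §8).
[cite: MumfordFogartyKirwan1994, Ch. 6 §2 (p. 121)] [cite: MilneAV2008, I §8 (pp. 36–37)] -/
def rigidify (P : (A.prodLeft B).Modules) : (A.prodLeft B).Modules :=
  tensorObj P (Modules.dual ((Scheme.Modules.pullback (pullback.snd A.X.hom B.X.hom)).obj
    ((Scheme.Modules.pullback (A.unitSlice B)).obj P)))

variable {A B} {P : (A.prodLeft B).Modules} (hP : HasRank P 1)
include hP

/-- The twisting module `(pr_B^* (ε × 1)^* P)^∨` has rank one. [cite: Hartshorne1977, II Prop. 6.12] -/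
theorem hasRank_twist :
    HasRank (Modules.dual ((Scheme.Modules.pullback (pullback.snd A.X.hom B.X.hom)).obj
      ((Scheme.Modules.pullback (A.unitSlice B)).obj P))) 1 :=
  hasRank_dual (hasRank_pullback _ (hasRank_pullback _ hP))

/-- `rigidify P` is a line bundle. [cite: Hartshorne1977, II Prop. 6.12] -/
theorem hasRank_rigidify : HasRank (A.rigidify B P) 1 :=
  hasRank_tensorObj_one hP (hasRank_twist hP)

/-- The class of the twisting module: `[(pr_B^* (ε × 1)^* P)^∨] = (pr_B^* (ε × 1)^* [P])⁻¹`.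
[cite: Hartshorne1977, II Ex. 6.8 and Ex. 6.11] -/
theorem detClass_twist (h : IsFiniteLocallyFree (Modules.dual ((Scheme.Modules.pullback
      (pullback.snd A.X.hom B.X.hom)).obj ((Scheme.Modules.pullback (A.unitSlice B)).obj P)))) :
    detClass h = (CechPic.pullback (pullback.snd A.X.hom B.X.hom)
      (CechPic.pullback (A.unitSlice B) (detClass (HasRank.isFiniteLocallyFree' hP))))⁻¹ := by
  have hP₁ := HasRank.isFiniteLocallyFree' hP
  rw [detClass_dual' ((hP₁.pullback (A.unitSlice B)).pullback (pullback.snd A.X.hom B.X.hom)) h,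
    detClass_pullback (hE := hP₁.pullback (A.unitSlice B)), detClass_pullback (hE := hP₁)]

/-- The class of the rigidification: `[rigidify P] = [P] · (pr_B^* (ε × 1)^* [P])⁻¹`.
[cite: Hartshorne1977, II Ex. 6.11] -/
theorem detClass_rigidify (h : IsFiniteLocallyFree (A.rigidify B P)) :
    detClass h = detClass (HasRank.isFiniteLocallyFree' hP) *
      (CechPic.pullback (pullback.snd A.X.hom B.X.hom)
        (CechPic.pullback (A.unitSlice B) (detClass (HasRank.isFiniteLocallyFree' hP))))⁻¹ := by
  have hP₁ := HasRank.isFiniteLocallyFree' hP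
  have hT₁ := HasRank.isFiniteLocallyFree' (hasRank_twist hP)
  rw [← detClass_twist hP hT₁]
  exact detClass_tensorObj_of_hasRank_one hP (hasRank_twist hP) hP₁ hT₁ h

/-- **`(ε_A × 1_B)^* (rigidify P) ≅ 𝒪_B`** — `rigidify P` is rigidified along `ε_A × 1_B`: since `(ε × 1) ≫ pr_B = 𝟙`
(★ `unitSlice_snd`), its class pulls back to `ε^*[P] · (ε^*[P])⁻¹ = 1`.
[cite: MumfordFogartyKirwan1994, Ch. 6 §2 (p. 121)] [cite: MilneAV2008, I §8 (pp. 36–37)] -/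
theorem nonempty_pullback_unitSlice_rigidify_iso :
    Nonempty ((Scheme.Modules.pullback (A.unitSlice B)).obj (A.rigidify B P) ≅ SheafOfModules.unit _) := by
  have hR := hasRank_rigidify hP
  have hR₁ := HasRank.isFiniteLocallyFree' hR
  refine nonempty_iso_unitModule_of_detClass_eq_one (hasRank_pullback _ hR) (hR₁.pullback _) ?_
  rw [detClass_pullback (hE := hR₁), detClass_rigidify hP hR₁, map_mul, map_inv, ← CechPic.pullback_comp,
    ← CechPic.pullback_comp, unitSlice_snd, Category.id_comp, mul_inv_cancel]

/-- **The slices of `rigidify P` are translation invariant iff those of `P` are** (clause (a) of ★ `DualPair` is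
insensitive to the rigidification): at a geometric point `b` of `B` (base point `s`) the slice of the twist is
`π_s^* (b^* (ε × 1)^* P)^∨`, pulled back from `Spec Ω`. [cite: MumfordAV1970, §8 ((iv) ⇔ (i))]
[cite: MilneAV2008, I §8 (pp. 36–37)] -/
theorem isHomogeneous_fibreSlice_rigidify_iff {Ω : Type u} [Field Ω] (b : Spec (.of Ω) ⟶ B.X.left) :
    IsHomogeneous (A.fibre (b ≫ B.X.hom)).toAbelianVariety
        ((Scheme.Modules.pullback (A.fibreSlice B b)).obj (A.rigidify B P)) ↔
      IsHomogeneous (A.fibre (b ≫ B.X.hom)).toAbelianVariety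
        ((Scheme.Modules.pullback (A.fibreSlice B b)).obj P) := by
  have hT := hasRank_twist hP
  -- the slice of the twist is pulled back from `Spec Ω`
  let N : (Spec (.of Ω)).Modules := (Scheme.Modules.pullback b).obj
    (Modules.dual ((Scheme.Modules.pullback (A.unitSlice B)).obj P))
  have hN : HasRank N 1 := hasRank_pullback _ (hasRank_dual (hasRank_pullback _ hP))
  obtain ⟨e₁⟩ := nonempty_pullback_tensorObj_iso (A.fibreSlice B b) hP hT
  obtain ⟨e₂⟩ := nonempty_pullback_dual_iso (pullback.snd A.X.hom B.X.hom) (hasRank_pullback (A.unitSlice B) hP)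
  -- `slice^* pr_B^* D ≅ (pr_Ω ≫ b)^* D ≅ π_s^* (b^* D)` for the dual `D` of `(ε × 1)^* P`
  have e₃ : (Scheme.Modules.pullback (A.fibreSlice B b)).obj (Modules.dual ((Scheme.Modules.pullback
      (pullback.snd A.X.hom B.X.hom)).obj ((Scheme.Modules.pullback (A.unitSlice B)).obj P))) ≅
      (Scheme.Modules.pullback (A.fibre (b ≫ B.X.hom)).toAbelianVariety.X.hom).obj N :=
    (Scheme.Modules.pullback (A.fibreSlice B b)).mapIso e₂.symm ≪≫
      (Scheme.Modules.pullbackComp _ _).app _ ≪≫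
      (Scheme.Modules.pullbackCongr (A.fibreSlice_snd B b)).app _ ≪≫
      ((Scheme.Modules.pullbackComp _ _).app _).symm
  rw [isHomogeneous_iff_of_iso _ (e₁ ≪≫ tensorMapIso (Iso.refl _) e₃)]
  exact isHomogeneous_tensorObj_pullback_hom_iff (A.fibre (b ≫ B.X.hom)).toAbelianVariety
    (hasRank_pullback _ hP) hN


/-! ### §3 Compatibility with `1_A × q` for an `S`-morphism `q : B′ → B` of parameter schemes -/

section WhiskerLeft

variable (A B) (B' : AbelianSchemeOver S) (q : B'.X ⟶ B.X)

omit hP in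
/-- **`(ε_A × 1_{B′}) ≫ (1_A × q) = q ≫ (ε_A × 1_B)`** (both are `(π′ ≫ ε_A, q)`). [cite: MilneAV2008, I §8 (pp. 36–37)] -/
theorem unitSlice_comp_whiskerLeft_left : A.unitSlice B' ≫ (A.X ◁ q).left = q.left ≫ A.unitSlice B := by
  have l₀ : (A.unitSlice B' ≫ (A.X ◁ q).left) ≫ pullback.fst A.X.hom B.X.hom = B'.X.hom ≫ A.unitSection :=
    (Category.assoc _ _ _).trans
      ((congrArg (fun x => A.unitSlice B' ≫ x) (Over.whiskerLeft_left_fst (R := A.X) q)).trans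
        (A.unitSlice_fst B'))
  have l₁ : (A.unitSlice B' ≫ (A.X ◁ q).left) ≫ pullback.snd A.X.hom B.X.hom = q.left :=
    (Category.assoc _ _ _).trans
      ((congrArg (fun x => A.unitSlice B' ≫ x) (Over.whiskerLeft_left_snd (R := A.X) q)).trans
        ((Category.assoc _ _ _).symm.trans
          ((congrArg (fun x => x ≫ q.left) (A.unitSlice_snd B')).trans (Category.id_comp _))))
  apply pullback.hom_ext
  · rw [l₀, Category.assoc, unitSlice_fst, ← Category.assoc, Over.w q]
  · rw [l₁, Category.assoc, unitSlice_snd, Category.comp_id]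

omit hP in
/-- The unit section of the base-changed abelian scheme `A_{B′} = A ×_S B′ → B′` IS the unit slice `ε_A × 1_{B′}`
(both are `(π′ ≫ ε_A, 𝟙)`; ★ `unitSection_baseChange_hat_eq_unitSlice` is the case `B′ = Â`).
[cite: MumfordFogartyKirwan1994, Ch. 6 §2 (p. 121)] -/
theorem unitSection_baseChange_eq_unitSlice : (A.baseChange B'.X.hom).unitSection = A.unitSlice B' := by
  have hsec : (A.baseChange B'.X.hom).unitSection ≫ pullback.snd A.X.hom B'.X.hom = 𝟙 _ :=
    (A.baseChange B'.X.hom).unitSection_comp_hom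
  apply pullback.hom_ext
  · exact (unitSection_baseChange_comp_fst A B'.X.hom).trans (A.unitSlice_fst B').symm
  · exact hsec.trans (A.unitSlice_snd B').symm

variable {A B B'}

omit hP in
/-- The class of a RIGIDIFIED line bundle on `A_{B′}` dies on `ε_A × 1_{B′}`. [cite: MilneAV2008, I §8 (pp. 36–37)] -/
theorem cechPic_pullback_unitSlice_detClass_eq_one (ℒ : A.RigidifiedLineBundle B'.X.hom)
    (h : IsFiniteLocallyFree ℒ.L) : CechPic.pullback (A.unitSlice B') (detClass h) = 1 := by
  obtain ⟨r⟩ := ℒ.rigid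
  have h' : CechPic.pullback (A.baseChange B'.X.hom).unitSection (detClass h) = 1 := by
    rw [← detClass_pullback (hE := h), detClass_eq_of_iso r (h.pullback _)
      (HasRank.isFiniteLocallyFree' hasRank_unitModule)]
    exact detClass_unitModule_eq_one _
  exact (congrArg (fun m => CechPic.pullback m (detClass h)) (A.unitSection_baseChange_eq_unitSlice B')).symm.trans h'

/-- **`(1_A × q)^* (rigidify P) ≅ ℒ.L` whenever `(1_A × q)^* P ≅ ℒ.L` for a RIGIDIFIED line bundle `ℒ` on `A_{B′}`**:
the twist pulls back to `pr_{B′}^* (q^* (ε × 1_B)^* P)^∨ = pr_{B′}^* ((ε × 1_{B′})^* (1 × q)^* P)^∨ ≅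
pr_{B′}^* ((ε × 1_{B′})^* ℒ.L)^∨ ≅ 𝒪`.  (So the defining isomorphism `(1 × ψ̂)^* 𝒫_B ≅ 𝒩₁` of a descended
Poincaré sheaf survives the rigidification of `𝒫_B`.) [cite: MumfordFogartyKirwan1994, Ch. 6 §2 (p. 121)]
[cite: MilneAV2008, I §8 (pp. 36–37)] -/
theorem nonempty_pullback_whiskerLeft_rigidify_iso (ℒ : A.RigidifiedLineBundle B'.X.hom)
    (e : Nonempty ((Scheme.Modules.pullback (A.X ◁ q).left).obj P ≅ ℒ.L)) :
    Nonempty ((Scheme.Modules.pullback (A.X ◁ q).left).obj (A.rigidify B P) ≅ ℒ.L) := by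
  obtain ⟨e⟩ := e
  have hP₁ := HasRank.isFiniteLocallyFree' hP
  have hR := hasRank_rigidify hP
  have hR₁ := HasRank.isFiniteLocallyFree' hR
  have hL₁ := HasRank.isFiniteLocallyFree' ℒ.hasRank_one
  -- `(1 × q)^*[P] = [ℒ.L]`
  have h1 : CechPic.pullback (A.X ◁ q).left (detClass hP₁) = detClass hL₁ :=
    (detClass_pullback (f := (A.X ◁ q).left) (hE := hP₁)).symm.trans (detClass_eq_of_iso e _ _)
  -- `(1 × q) ≫ pr_B ≫ (ε × 1_B) = pr_{B′} ≫ (ε × 1_{B′}) ≫ (1 × q)`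
  have hcomp : (A.X ◁ q).left ≫ pullback.snd A.X.hom B.X.hom ≫ A.unitSlice B =
      pullback.snd A.X.hom B'.X.hom ≫ A.unitSlice B' ≫ (A.X ◁ q).left := by
    rw [A.unitSlice_comp_whiskerLeft_left B B' q, ← Category.assoc, ← Category.assoc]
    exact congrArg (fun x => x ≫ A.unitSlice B) (Over.whiskerLeft_left_snd (R := A.X) q)
  -- the twist dies after `(1 × q)^*`
  have h2 : CechPic.pullback (A.X ◁ q).left (CechPic.pullback (pullback.snd A.X.hom B.X.hom)
      (CechPic.pullback (A.unitSlice B) (detClass hP₁))) = 1 :=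
    calc CechPic.pullback (A.X ◁ q).left (CechPic.pullback (pullback.snd A.X.hom B.X.hom)
          (CechPic.pullback (A.unitSlice B) (detClass hP₁)))
        = CechPic.pullback (A.X ◁ q).left (CechPic.pullback (pullback.snd A.X.hom B.X.hom ≫ A.unitSlice B)
            (detClass hP₁)) := by rw [CechPic.pullback_comp]
      _ = CechPic.pullback ((A.X ◁ q).left ≫ pullback.snd A.X.hom B.X.hom ≫ A.unitSlice B) (detClass hP₁) :=
            (CechPic.pullback_comp _ _ _).symm
      _ = CechPic.pullback (pullback.snd A.X.hom B'.X.hom ≫ A.unitSlice B' ≫ (A.X ◁ q).left) (detClass hP₁) :=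
            congrArg (fun m => CechPic.pullback m (detClass hP₁)) hcomp
      _ = CechPic.pullback (pullback.snd A.X.hom B'.X.hom) (CechPic.pullback (A.unitSlice B')
            (CechPic.pullback (A.X ◁ q).left (detClass hP₁))) :=
            (CechPic.pullback_comp _ _ _).trans (congrArg _ (CechPic.pullback_comp _ _ _))
      _ = 1 := by rw [h1, cechPic_pullback_unitSlice_detClass_eq_one ℒ hL₁, map_one]
  refine (nonempty_iso_iff_detClass_eq (hasRank_pullback _ hR) ℒ.hasRank_one (hR₁.pullback _) hL₁).2 ?_
  erw [detClass_pullback (hE := hR₁), detClass_rigidify hP hR₁, map_mul, map_inv, h1, h2, inv_one, mul_one]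

end WhiskerLeft

/-! ### §4 Rigidification removes the `Pic(T)`-ambiguity in universality statements -/

section TwistKiller

variable {T : Scheme.{u}} {f : T ⟶ S} (g : T ⟶ B.X.left) (hg : g ≫ B.X.hom = f)

omit hP in
/-- `ε_T ≫ (1_A × g) = g ≫ (ε_A × 1_B)` (both are `(f ≫ ε_A, g)`). [cite: MilneAV2008, I §8 (pp. 36–37)] -/
theorem unitSection_baseChange_comp_baseChangeToProd :
    (A.baseChange f).unitSection ≫ A.baseChangeToProd B f g hg = g ≫ A.unitSlice B := by
  have hsec : (A.baseChange f).unitSection ≫ pullback.snd A.X.hom f = 𝟙 _ := (A.baseChange f).unitSection_comp_hom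
  apply pullback.hom_ext
  · rw [Category.assoc, baseChangeToProd_fst, unitSection_baseChange_comp_fst, Category.assoc, unitSlice_fst,
      ← Category.assoc, hg]
  · rw [Category.assoc, baseChangeToProd_snd, ← Category.assoc, hsec, Category.id_comp, Category.assoc,
      unitSlice_snd, Category.comp_id]

/-- **The twist-killer.**  If `P` is rigidified along `ε_A × 1_B`, `ℒ` is a rigidified line bundle on `A_T`, and
`(1_A × g)^* P ≅ ℒ.L ⊗ pr_T^* M` for a line bundle `M` on `T`, then `M ≅ 𝒪_T` — restrict along the unit section
`ε_T`: `ε_T ≫ (1 × g) = g ≫ (ε × 1)` kills the left side, `ε_T ≫ pr_T = 𝟙` reads off `[M]` on the right.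
[cite: MilneAV2008, I §8 (pp. 36–37)] [cite: MumfordAV1970, §13 (p. 125)] -/
theorem nonempty_iso_unit_of_pullback_iso_tensorObj
    (hPr : Nonempty ((Scheme.Modules.pullback (A.unitSlice B)).obj P ≅ SheafOfModules.unit _))
    (ℒ : A.RigidifiedLineBundle f) {M : T.Modules} (hM : HasRank M 1)
    (e : Nonempty ((Scheme.Modules.pullback (A.baseChangeToProd B f g hg)).obj P ≅
      tensorObj ℒ.L ((Scheme.Modules.pullback (pullback.snd A.X.hom f)).obj M))) :
    Nonempty (M ≅ SheafOfModules.unit _) := by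
  obtain ⟨e⟩ := e
  obtain ⟨r⟩ := hPr
  obtain ⟨rL⟩ := ℒ.rigid
  have hP₁ := HasRank.isFiniteLocallyFree' hP
  have hL₁ := HasRank.isFiniteLocallyFree' ℒ.hasRank_one
  have hM₁ := HasRank.isFiniteLocallyFree' hM
  have hu₁ : IsFiniteLocallyFree (SheafOfModules.unit T.ringCatSheaf) := HasRank.isFiniteLocallyFree' hasRank_unitModule
  have hsec : (A.baseChange f).unitSection ≫ pullback.snd A.X.hom f = 𝟙 _ := (A.baseChange f).unitSection_comp_hom
  -- `[ε^*P] = 1` on `B`, `[ε_T^* ℒ.L] = 1` on `T`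
  have hεP : CechPic.pullback (A.unitSlice B) (detClass hP₁) = 1 := by
    rw [← detClass_pullback (hE := hP₁), detClass_eq_of_iso r (hP₁.pullback _)
      (HasRank.isFiniteLocallyFree' hasRank_unitModule)]
    exact detClass_unitModule_eq_one _
  have hεL : CechPic.pullback (A.baseChange f).unitSection (detClass hL₁) = 1 := by
    rw [← detClass_pullback (hE := hL₁), detClass_eq_of_iso rL (hL₁.pullback _) hu₁]
    exact detClass_unitModule_eq_one _
  -- read the class identity of `e` after `ε_T^*`
  have hcl := congrArg (CechPic.pullback (A.baseChange f).unitSection)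
    ((detClass_pullback (f := A.baseChangeToProd B f g hg) (hE := hP₁)).symm.trans
      (detClass_eq_of_iso e (hP₁.pullback _)
        (isFiniteLocallyFree_tensorObj _ _ hL₁ (hM₁.pullback (pullback.snd A.X.hom f)))))
  erw [← CechPic.pullback_comp, A.unitSection_baseChange_comp_baseChangeToProd g hg, CechPic.pullback_comp, hεP,
    map_one, detClass_tensorObj_of_hasRank_one ℒ.hasRank_one (hasRank_pullback _ hM) hL₁ (hM₁.pullback _), map_mul,
    hεL, one_mul, detClass_pullback (hE := hM₁), ← CechPic.pullback_comp, hsec, CechPic.pullback_id_apply] at hcl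
  exact nonempty_iso_unitModule_of_detClass_eq_one hM hM₁ hcl.symm

/-- **Hence `(1_A × g)^* P ≅ ℒ.L`** under the hypotheses of `nonempty_iso_unit_of_pullback_iso_tensorObj`
(`[pr_T^* M] = pr_T^* 1 = 1`). [cite: MilneAV2008, I §8 (pp. 36–37)] [cite: MumfordAV1970, §13 (p. 125)] -/
theorem nonempty_pullback_iso_of_iso_tensorObj
    (hPr : Nonempty ((Scheme.Modules.pullback (A.unitSlice B)).obj P ≅ SheafOfModules.unit _))
    (ℒ : A.RigidifiedLineBundle f) {M : T.Modules} (hM : HasRank M 1)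
    (e : Nonempty ((Scheme.Modules.pullback (A.baseChangeToProd B f g hg)).obj P ≅
      tensorObj ℒ.L ((Scheme.Modules.pullback (pullback.snd A.X.hom f)).obj M))) :
    Nonempty ((Scheme.Modules.pullback (A.baseChangeToProd B f g hg)).obj P ≅ ℒ.L) := by
  obtain ⟨i⟩ := nonempty_iso_unit_of_pullback_iso_tensorObj hP g hg hPr ℒ hM e
  obtain ⟨e⟩ := e
  have hP₁ := HasRank.isFiniteLocallyFree' hP
  have hL₁ := HasRank.isFiniteLocallyFree' ℒ.hasRank_one
  have hM₁ := HasRank.isFiniteLocallyFree' hM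
  have hu₁ : IsFiniteLocallyFree (SheafOfModules.unit T.ringCatSheaf) := HasRank.isFiniteLocallyFree' hasRank_unitModule
  have hM1 : detClass hM₁ = 1 := (detClass_eq_of_iso i hM₁ hu₁).trans (detClass_unitModule_eq_one _)
  refine (nonempty_iso_iff_detClass_eq (hasRank_pullback _ hP) ℒ.hasRank_one (hP₁.pullback _) hL₁).2 ?_
  erw [detClass_eq_of_iso e (hP₁.pullback _) (isFiniteLocallyFree_tensorObj _ _ hL₁ (hM₁.pullback (pullback.snd A.X.hom f))),
    detClass_tensorObj_of_hasRank_one ℒ.hasRank_one (hasRank_pullback _ hM) hL₁ (hM₁.pullback _),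
    detClass_pullback (hE := hM₁), hM1, map_one, mul_one]

end TwistKiller

end AbelianSchemeOver

end Literature.AlgebraicGeometry.AbelianSchemes

end
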